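import Summits.ABC.IUTFork.Repair.RHRound4ConstraintRequirementsC
import Mathlib.NumberTheory.NumberField.Units.DirichletTheorem
import Mathlib.NumberTheory.NumberField.ClassNumber
import Mathlib.NumberTheory.NumberField.ProductFormula
import HarnessLib

/-!
# R-H ROUND 4, row R4-7, part C — PROOF-ONLY COMPANION (2): §V5 R-V5-1's typed obstruction DEGREE RIGIDITY is a THEOREM
# (Dirichlet's unit theorem + finiteness of the class group + the product formula, all BY NAME from Mathlib)

abc-iut cell, rung LADDER-ABC:A2.RESCUE.H; seat abc-iut-L5-t8 (GEN 12, 2026-08-27; requirements owner of `Repair/RHRound4ConstraintRequirementsC.lean`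
★ p540469). Census O-14 (sheet V5 `ROUND4/R4-7-V5-abc-iut-rh3-gen-5.md` 4bfc176e2f725617, item R-V5-1 «the RE-WEIGHTED GLOBAL VOLUME») carries the typed
obstruction `V5_R1_degreeRigidity K` — «a place-weighted sum of local log-norms that kills every principal idele is a constant multiple of the degree»
— which part C typed as `@[folklore]`, «a classical statement, NOT proved here». THIS FILE PROVES IT for every number field `K`:

  `V5_R1_degreeRigidity_holds (K) : V5_R1_degreeRigidity K`.

Proof (classical; Mathlib BY NAME). Let `π` be place weights with `Σ_w π_w·mult(w)·log|x|_w + Σᶠ_v π_v·log|x|_v = 0` for all `x ∈ K^×`, and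
`c := π_{w₀}` at Dirichlet's distinguished infinite place `w₀` (`NumberField.Units.dirichletUnitTheorem.w₀`).
* UNITS (`finitePlace_apply_unit`): a unit `u ∈ (𝓞 K)^×` has `|u|_v = 1` at every finite place (`FinitePlace.norm_eq_one_iff_notMem`), so the
  hypothesis at `u` reads `Σ_w π_w·mult(w)·log|u|_w = 0` (`sum_weights_log_unit_eq_zero`); with `Σ_w mult(w)·log|u|_w = 0` (`NumberField.Units.sum_mult_mul_log`)
  the `ℝ`-linear functional `y ↦ Σ_{w ≠ w₀} (π_w − c)·y_w` on Dirichlet's log space kills the logarithmic embedding of every unit, i.e. the unit lattice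
  (`NumberField.Units.unitLattice`); that lattice SPANS the log space (`unitLattice_span_eq_top`, Dirichlet's unit theorem), so the functional is `0` and
  `π_w = c` at every infinite place (`weight_infinitePlace_eq`).
* FINITE PLACES (`weight_finitePlace_eq`): for a finite place `v₀` with prime `P`, the class of `P` has finite order (`Fintype (ClassGroup (𝓞 K))`,
  `ClassGroup.mk0_eq_one_iff`), so `P^h = (a)` for `h = #Cl(K)` and some `a ∈ 𝓞 K ∖ 0` (`exists_pow_card_classGroup_eq_span`); then `|a|_v = 1` at every
  finite `v ≠ v₀` and `0 < |a|_{v₀} < 1` (`FinitePlace.norm_lt_one_iff_mem`), the hypothesis at `a` reads `c·A + π_{v₀}·B = 0` with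
  `A = Σ_w mult(w)·log|a|_w`, `B = log|a|_{v₀} ≠ 0`, and the product formula (`NumberField.prod_abs_eq_one`) gives `A + B = 0`; hence `π_{v₀} = c`.
So O-14's obstruction is no longer a hypothesis: under NO non-constant place weighting is the weighted log-volume of principal ideles trivial — the only
«degree» available to a π-theory is (a multiple of) print's. HONEST FRAMING: a classical theorem about number fields, proved in OUR kernel from Mathlib;
it says nothing about [IUTchI–IV] beyond sharpening OUR census cell O-14 (R-V5-1 INCONSISTENT-as-typed for non-constant `π`, by a THEOREM rather than a
folklore tag); typed requirement Props license nothing; located ≠ adjudicated; no side on [IUTchIII] Cor 3.12 / [IUTchIV] Thm 1.10 / Prop 1.7 / Cor 2.2 or on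
any author (D-0045); nothing here asserts that abc is proved or refuted. PROOF-ONLY file: 0 `def`, 0 new `Prop` facts, no `instance` / `notation` / `macro`;
FROZEN FACT-LIST f75a60bac22efdb6 untouched. [folklore] for the number theory (Dirichlet 1846; Dedekind; Artin–Whaples 1945 for the product-formula axiomatics).
-/

noncomputable section

namespace Summit.ABC.IUTFork.Repair.RH.Round4ConstraintRequirements

open NumberField NumberField.InfinitePlace NumberField.FinitePlace NumberField.Units
  NumberField.Units.dirichletUnitTheorem IsDedekindDomain

section V5RigidityDischarge

variable {K : Type*} [Field K] [NumberField K]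

/-- A unit of `𝓞 K` has absolute value `1` at every finite place (it lies in no prime). [folklore] -/
theorem finitePlace_apply_unit (v : FinitePlace K) (u : (𝓞 K)ˣ) : v ((u : 𝓞 K) : K) = 1 := by
  rw [← norm_embedding_eq v]
  exact (norm_eq_one_iff_notMem K v.maximalIdeal (u : 𝓞 K)).mpr fun h =>
    v.maximalIdeal.isPrime.ne_top (Ideal.eq_top_of_isUnit_mem _ h u.isUnit)

/-- At a unit the finite part of the weighted sum vanishes, so the hypothesis of `V5_R1_degreeRigidity` reads `Σ_w π_w·mult(w)·log|u|_w = 0`. [folklore] -/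
theorem sum_weights_log_unit_eq_zero (π : InfinitePlace K ⊕ FinitePlace K → ℝ)
    (hπ : ∀ x : K, x ≠ 0 →
      (∑ w : InfinitePlace K, π (Sum.inl w) * (w.mult : ℝ) * Real.log (w x)) +
        ∑ᶠ v : FinitePlace K, π (Sum.inr v) * Real.log (v x) = 0)
    (u : (𝓞 K)ˣ) :
    ∑ w : InfinitePlace K, π (Sum.inl w) * (w.mult : ℝ) * Real.log (w ((u : 𝓞 K) : K)) = 0 := by
  have h := hπ ((u : 𝓞 K) : K) (coe_ne_zero u)
  have hfin : ∑ᶠ v : FinitePlace K, π (Sum.inr v) * Real.log (v ((u : 𝓞 K) : K)) = 0 :=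
    finsum_eq_zero_of_forall_eq_zero fun v => by rw [finitePlace_apply_unit, Real.log_one, mul_zero]
  rwa [hfin, add_zero] at h

/-- **Infinite places: the weights are constant** (Dirichlet). The functional `y ↦ Σ_{w ≠ w₀} (π_w − π_{w₀})·y_w` on the log space kills the unit lattice,
which spans (`unitLattice_span_eq_top`); so it is zero. [folklore] -/
theorem weight_infinitePlace_eq (π : InfinitePlace K ⊕ FinitePlace K → ℝ)
    (hπ : ∀ x : K, x ≠ 0 →
      (∑ w : InfinitePlace K, π (Sum.inl w) * (w.mult : ℝ) * Real.log (w x)) +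
        ∑ᶠ v : FinitePlace K, π (Sum.inr v) * Real.log (v x) = 0)
    (w : InfinitePlace K) : π (Sum.inl w) = π (Sum.inl (w₀ : InfinitePlace K)) := by
  classical
  set c : ℝ := π (Sum.inl (w₀ : InfinitePlace K)) with hc
  -- the functional on Dirichlet's log space
  let Φ : logSpace K →ₗ[ℝ] ℝ :=
    { toFun := fun y => ∑ w' : {w' : InfinitePlace K // w' ≠ w₀}, (π (Sum.inl w'.1) - c) * y w'
      map_add' := fun y z => by
        simp only [Pi.add_apply, mul_add, Finset.sum_add_distrib]
      map_smul' := fun r y => by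
        simp only [Pi.smul_apply, smul_eq_mul, RingHom.id_apply, Finset.mul_sum, mul_left_comm] }
  have hΦ : ∀ y, Φ y = ∑ w' : {w' : InfinitePlace K // w' ≠ w₀}, (π (Sum.inl w'.1) - c) * y w' := fun _ => rfl
  -- it kills the logarithmic embedding of every unit
  have hunit : ∀ u : (𝓞 K)ˣ, Φ (logEmbedding K (Additive.ofMul u)) = 0 := by
    intro u
    have h1 := sum_weights_log_unit_eq_zero π hπ u
    have h2 := sum_mult_mul_log u
    have h3 : ∑ w' : InfinitePlace K,
        (π (Sum.inl w') - c) * ((w'.mult : ℝ) * Real.log (w' ((u : 𝓞 K) : K))) = 0 := by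
      have : ∑ w' : InfinitePlace K, (π (Sum.inl w') - c) * ((w'.mult : ℝ) * Real.log (w' ((u : 𝓞 K) : K))) =
          (∑ w' : InfinitePlace K, π (Sum.inl w') * (w'.mult : ℝ) * Real.log (w' ((u : 𝓞 K) : K))) -
            c * ∑ w' : InfinitePlace K, (w'.mult : ℝ) * Real.log (w' ((u : 𝓞 K) : K)) := by
        rw [Finset.mul_sum, ← Finset.sum_sub_distrib]
        exact Finset.sum_congr rfl fun w' _ => by ring
      rw [this, h1, h2, mul_zero, sub_zero]
    rw [Fintype.sum_eq_add_sum_subtype_ne _ w₀, ← hc, sub_self, zero_mul, zero_add] at h3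
    rw [hΦ]
    simpa only [logEmbedding_component] using h3
  -- hence it kills the unit lattice, which spans the log space: `Φ = 0`
  have hker : (unitLattice K : Set (logSpace K)) ⊆ (LinearMap.ker Φ : Set (logSpace K)) := by
    intro y hy
    obtain ⟨x, -, rfl⟩ := Submodule.mem_map.mp hy
    exact hunit (Additive.toMul x)
  have hΦ0 : LinearMap.ker Φ = ⊤ := by
    rw [eq_top_iff, ← unitLattice_span_eq_top K]
    exact Submodule.span_le.mpr hker
  by_cases hw : w = w₀
  · rw [hw]
  · have hmem : (Pi.single (⟨w, hw⟩ : {w' : InfinitePlace K // w' ≠ w₀}) (1 : ℝ) : logSpace K) ∈ LinearMap.ker Φ := by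
      rw [hΦ0]; exact Submodule.mem_top
    rw [LinearMap.mem_ker, hΦ, Finset.sum_eq_single (⟨w, hw⟩ : {w' : InfinitePlace K // w' ≠ w₀})
      (fun w' _ hw' => by rw [Pi.single_eq_of_ne hw', mul_zero]) (fun h => absurd (Finset.mem_univ _) h),
      Pi.single_eq_same, mul_one] at hmem
    exact sub_eq_zero.mp hmem

/-- Finiteness of the class group: some power of every nonzero prime of `𝓞 K` is principal, `P^h = (a)` with `h = #Cl(𝓞 K)`. [folklore] -/
theorem exists_pow_card_classGroup_eq_span (P : HeightOneSpectrum (𝓞 K)) :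
    ∃ a : 𝓞 K, P.asIdeal ^ Fintype.card (ClassGroup (𝓞 K)) = Ideal.span {a} := by
  have hP : P.asIdeal ∈ nonZeroDivisors (Ideal (𝓞 K)) := mem_nonZeroDivisors_of_ne_zero P.ne_bot
  have hPh : P.asIdeal ^ Fintype.card (ClassGroup (𝓞 K)) ∈ nonZeroDivisors (Ideal (𝓞 K)) :=
    mem_nonZeroDivisors_of_ne_zero (pow_ne_zero _ P.ne_bot)
  have h1 : ClassGroup.mk0 ⟨_, hPh⟩ = 1 := by
    have : (⟨_, hPh⟩ : nonZeroDivisors (Ideal (𝓞 K))) = ⟨P.asIdeal, hP⟩ ^ Fintype.card (ClassGroup (𝓞 K)) :=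
      Subtype.ext rfl
    rw [this, map_pow, pow_card_eq_one]
  exact ((ClassGroup.mk0_eq_one_iff hPh).mp h1).principal

/-- **Finite places: the weight equals the archimedean constant** (class group + product formula). [folklore] -/
theorem weight_finitePlace_eq (π : InfinitePlace K ⊕ FinitePlace K → ℝ)
    (hπ : ∀ x : K, x ≠ 0 →
      (∑ w : InfinitePlace K, π (Sum.inl w) * (w.mult : ℝ) * Real.log (w x)) +
        ∑ᶠ v : FinitePlace K, π (Sum.inr v) * Real.log (v x) = 0)
    {c : ℝ} (hinf : ∀ w : InfinitePlace K, π (Sum.inl w) = c) (v₀ : FinitePlace K) :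
    π (Sum.inr v₀) = c := by
  classical
  set P : HeightOneSpectrum (𝓞 K) := v₀.maximalIdeal with hP
  set h : ℕ := Fintype.card (ClassGroup (𝓞 K)) with hh
  have hh0 : h ≠ 0 := Fintype.card_ne_zero
  obtain ⟨a, ha⟩ := exists_pow_card_classGroup_eq_span P
  -- `a ≠ 0`
  have ha0 : a ≠ 0 := by
    rintro rfl
    have : P.asIdeal ^ h = ⊥ := by
      rw [hh, ha]
      exact Ideal.span_singleton_eq_bot.mpr rfl
    exact pow_ne_zero _ P.ne_bot this
  have ha0K : ((a : 𝓞 K) : K) ≠ 0 := fun h0 => ha0 (RingOfIntegers.coe_eq_zero_iff.mp h0)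
  -- membership of `a` in the primes: `a ∈ Q ↔ Q = P`
  have hmem : ∀ v : FinitePlace K, a ∈ v.maximalIdeal.asIdeal ↔ v = v₀ := by
    intro v
    constructor
    · intro hav
      have hle : P.asIdeal ^ h ≤ v.maximalIdeal.asIdeal := by
        rw [hh, ha]
        exact (Ideal.span_singleton_le_iff_mem _).mpr hav
      have hle' : P.asIdeal ≤ v.maximalIdeal.asIdeal := (Ideal.IsPrime.pow_le_iff hh0).mp hle
      have hPQ : P.asIdeal = v.maximalIdeal.asIdeal :=
        P.isMaximal.eq_of_le v.maximalIdeal.isPrime.ne_top hle'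
      have : P = v.maximalIdeal := HeightOneSpectrum.ext hPQ
      rw [hP] at this
      exact ((maximalIdeal_inj v₀ v).mp this).symm
    · rintro rfl
      have hle : P.asIdeal ^ h ≤ P.asIdeal := Ideal.pow_le_self hh0
      apply hle
      rw [hh, ha]
      exact Ideal.mem_span_singleton_self a
  -- absolute values of `a`
  have hone : ∀ v : FinitePlace K, v ≠ v₀ → v ((a : 𝓞 K) : K) = 1 := fun v hv => by
    rw [← norm_embedding_eq v]
    exact (norm_eq_one_iff_notMem K v.maximalIdeal a).mpr fun hav => hv ((hmem v).mp hav)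
  have hlt : v₀ ((a : 𝓞 K) : K) < 1 := by
    rw [← norm_embedding_eq v₀]
    exact (norm_lt_one_iff_mem K v₀.maximalIdeal a).mpr ((hmem v₀).mpr rfl)
  have hpos : 0 < v₀ ((a : 𝓞 K) : K) := pos_iff.mpr ha0K
  have hB : Real.log (v₀ ((a : 𝓞 K) : K)) ≠ 0 := (Real.log_neg hpos hlt).ne
  -- the hypothesis at `a`: `c·A + π_{v₀}·B = 0`
  have hfin : ∑ᶠ v : FinitePlace K, π (Sum.inr v) * Real.log (v ((a : 𝓞 K) : K)) =
      π (Sum.inr v₀) * Real.log (v₀ ((a : 𝓞 K) : K)) :=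
    finsum_eq_single _ v₀ fun v hv => by rw [hone v hv, Real.log_one, mul_zero]
  have hinfsum : ∑ w : InfinitePlace K, π (Sum.inl w) * (w.mult : ℝ) * Real.log (w ((a : 𝓞 K) : K)) =
      c * ∑ w : InfinitePlace K, (w.mult : ℝ) * Real.log (w ((a : 𝓞 K) : K)) := by
    rw [Finset.mul_sum]
    exact Finset.sum_congr rfl fun w _ => by rw [hinf w, mul_assoc]
  have hyp := hπ ((a : 𝓞 K) : K) ha0K
  rw [hfin, hinfsum] at hyp
  -- the product formula at `a`: `A + B = 0`
  have hprod := prod_abs_eq_one ha0K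
  rw [finprod_eq_single _ v₀ fun v hv => hone v hv] at hprod
  have hne : ∀ w : InfinitePlace K, w ((a : 𝓞 K) : K) ^ w.mult ≠ 0 := fun w =>
    pow_ne_zero _ ((w.pos_iff).mpr ha0K).ne'
  have hlog := congr_arg Real.log hprod
  rw [Real.log_one, Real.log_mul (Finset.prod_ne_zero_iff.mpr fun w _ => hne w) hpos.ne',
    Real.log_prod (s := Finset.univ) (fun w _ => hne w)] at hlog
  simp only [Real.log_pow] at hlog
  -- `A = -B`, so `(π_{v₀} - c)·B = 0`
  have hA : ∑ w : InfinitePlace K, (w.mult : ℝ) * Real.log (w ((a : 𝓞 K) : K)) = -Real.log (v₀ ((a : 𝓞 K) : K)) := by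
    linarith
  rw [hA] at hyp
  have : (π (Sum.inr v₀) - c) * Real.log (v₀ ((a : 𝓞 K) : K)) = 0 := by linarith
  exact sub_eq_zero.mp ((mul_eq_zero.mp this).resolve_right hB)

/-- **DEGREE RIGIDITY HOLDS** (discharges the `@[folklore]` obstruction `V5_R1_degreeRigidity` of ★ p540469 §V5, census O-14 R-V5-1): for every number
field `K`, a place weighting `π` with `Σ_w π_w·mult(w)·log|x|_w + Σᶠ_v π_v·log|x|_v = 0` for all `x ∈ K^×` is CONSTANT (`= π_{w₀}`). Dirichlet's unit theorem
(`unitLattice_span_eq_top`) for the infinite places, finiteness of the class group (`Fintype (ClassGroup (𝓞 K))`) and the product formula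
(`prod_abs_eq_one`) for the finite ones. [folklore] -/
theorem V5_R1_degreeRigidity_holds (K : Type*) [Field K] [NumberField K] : V5_R1_degreeRigidity K := by
  intro π hπ
  refine ⟨π (Sum.inl (w₀ : InfinitePlace K)), fun v => ?_⟩
  rcases v with w | v
  · exact weight_infinitePlace_eq π hπ w
  · exact weight_finitePlace_eq π hπ (fun w => weight_infinitePlace_eq π hπ w) v

end V5RigidityDischarge

end Summit.ABC.IUTFork.Repair.RH.Round4ConstraintRequirements

end
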